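import Summits.Schanuel.Schanuel.Theorems.ZilberEacGraphRamifiedBranch
import Summits.Schanuel.Schanuel.Theorems.ZilberEacGraphReciprocalExamples
import HarnessLib

/-!
# The equimodular class, LXIV: EXAMPLES with a totally ramified top row —
# `{x₁ = p(x₀), x₀(y₀ - 1)^k + y₀ = 0}` is in Mantova–Masser's case and DENSE, for every `k ≥ 1`
# and every `p` of degree `≥ 2`

HONEST FRAMING.  Cell `pub-schanuel` (Zilber's Exponential-Algebraic Closedness, case ladder;
host summit Schanuel), seat 2, gen 26.  The fibre curve `x₀(y₀ - 1)^k + y₀ = 0` has rows of degree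
`≤ 1`, top row `T = (X - 1)^k` — for `k ≥ 2` NO simple nonzero root, so every theorem of gens 17–25
is silent — next row `T₁ = X` with `T₁(1) = 1 ≠ 0` (one `k`-cycle of branches `y₀ → 1` at
infinity, file LIII), and an unramified zero at `x₀ = 0` (`q₀ = (-1)^k x₀`, `q₁(0) = 1`).  By file
LXIII (`unprojectedDense_graph_ramifiedTopRow_unramified`):
**`unprojectedDensityQuestion_graph_ramifiedCycleFibre`** — for every `k ≥ 1` and every `p` with
`deg p ≥ 2`, `{x₁ = p(x₀), x₀(y₀ - 1)^k + y₀ = 0}` satisfies the hypotheses of Mantova–Masser's case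
(dim-π-S-1-free) AND has Zariski-dense exponential points; e.g. (`k = 2`)
**`unprojectedDense_cubicGraph_doubleRootFibre`**: `{x₁ = x₀³, x₀y₀² + (1 - 2x₀)y₀ + x₀ = 0}`.
Complete classes of instances of an OPEN question (Mantova–Masser, PLMS 2024 §1 p. 5); EC(3,2)
OPEN; NOT Schanuel's conjecture (neither used nor implied); EAC ⇏ SC.
-/

noncomputable section

open Filter Topology Set Complex MvPolynomial
open Literature.NumberTheory.Transcendental Literature.ModelTheory.Zilber
open Literature.ModelTheory.ExponentialFields

set_option linter.dupNamespace false

namespace Summit.Schanuel.Schanuel.Theorems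

/-- `x₀(y₀ - 1)^k + y₀` is irreducible (degree one in `x₀` with coprime coefficients `(y₀ - 1)^k`,
`y₀`). [folklore] -/
theorem irreducible_ramifiedCycleFibre (k : ℕ) :
    Irreducible (X 0 * (X 1 - 1) ^ k + X 1 : MvPolynomial (Fin 2) ℂ) := by
  have himage : MvPolynomial.finSuccEquiv ℂ 1 (X 0 * (X 1 - 1) ^ k + X 1) =
      Polynomial.C ((X 0 - 1) ^ k : MvPolynomial (Fin 1) ℂ) * Polynomial.X +
        Polynomial.C (X 0 : MvPolynomial (Fin 1) ℂ) := by
    rw [map_add, map_mul, map_pow, map_sub, map_one, MvPolynomial.finSuccEquiv_X_zero,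
      show (X 1 : MvPolynomial (Fin 2) ℂ) = X (Fin.succ 0) from rfl, MvPolynomial.finSuccEquiv_X_succ,
      map_pow, map_sub, map_one]
    ring
  have ha : ((X 0 - 1) ^ k : MvPolynomial (Fin 1) ℂ) ≠ 0 := by
    refine pow_ne_zero _ fun h => ?_
    have := congrArg (MvPolynomial.eval fun _ => (0 : ℂ)) h
    simp at this
  have hcop : IsCoprime ((X 0 - 1) ^ k : MvPolynomial (Fin 1) ℂ) (X 0) := by
    refine IsCoprime.pow_left ⟨-1, 1, by ring⟩
  have hirr := irreducible_C_mul_X_add_C_of_isCoprime ha hcop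
  rw [← himage] at hirr
  exact (MulEquiv.irreducible_iff (MvPolynomial.finSuccEquiv ℂ 1).toMulEquiv).1 hirr

/-- **`{x₁ = p(x₀), x₀(y₀ - 1)^k + y₀ = 0}` is in Mantova–Masser's case and DENSE**, for every
`k ≥ 1` and every `p` of degree `≥ 2` (top row `(X - 1)^k`: a `k`-cycle at infinity; unramified zero
at `x₀ = 0`). [cite: MantovaMasser2023, §1 Further remarks, p. 5 (the question, open in general)]
(new) -/
theorem unprojectedDensityQuestion_graph_ramifiedCycleFibre {k : ℕ} (hk : 1 ≤ k) (p : Polynomial ℂ)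
    (hd : 2 ≤ p.natDegree) :
    MMCaseDimPiOneFree {w : Fin 2 ⊕ Fin 2 → ℂ | w (Sum.inl 1) = p.eval (w (Sum.inl 0)) ∧
      w (Sum.inl 0) * (w (Sum.inr 0) - 1) ^ k + w (Sum.inr 0) = 0} ∧
    UnprojectedDense {w : Fin 2 ⊕ Fin 2 → ℂ | w (Sum.inl 1) = p.eval (w (Sum.inl 0)) ∧
      w (Sum.inl 0) * (w (Sum.inr 0) - 1) ^ k + w (Sum.inr 0) = 0} := by
  classical
  have hk0 : k ≠ 0 := by omega
  set P : MvPolynomial (Fin 2) ℂ := X 0 * (X 1 - 1) ^ k + X 1 with hPdef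
  have hset : {w : Fin 2 ⊕ Fin 2 → ℂ | w (Sum.inl 1) = p.eval (w (Sum.inl 0)) ∧
      w (Sum.inl 0) * (w (Sum.inr 0) - 1) ^ k + w (Sum.inr 0) = 0} =
      {w : Fin 2 ⊕ Fin 2 → ℂ | w (Sum.inl 1) = p.eval (w (Sum.inl 0)) ∧
        MvPolynomial.eval ![w (Sum.inl 0), w (Sum.inr 0)] P = 0} := by
    ext w
    simp only [Set.mem_setOf_eq, hPdef, MvPolynomial.eval_X, map_add, map_mul, map_pow, map_sub,
      map_one, Matrix.cons_val_zero, Matrix.cons_val_one]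
  rw [hset]
  have hirr : Irreducible P := irreducible_ramifiedCycleFibre k
  -- the rows: `Q = s·(t - 1)^k + t`
  set T : Polynomial ℂ := (Polynomial.X - Polynomial.C 1) ^ k with hTdef
  set Q : Polynomial (Polynomial ℂ) :=
    Polynomial.C Polynomial.X * T.map Polynomial.C + Polynomial.X with hQdef
  have hTmap : (T.map Polynomial.C : Polynomial (Polynomial ℂ)) =
      (Polynomial.X - Polynomial.C (Polynomial.C 1)) ^ k := by
    rw [hTdef, Polynomial.map_pow, Polynomial.map_sub, Polynomial.map_X, Polynomial.map_C]
  have hP : ∀ x y : ℂ, MvPolynomial.eval ![x, y] P = (Q.map (Polynomial.evalRingHom x)).eval y := by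
    intro x y
    rw [hQdef, hTmap]
    simp [hPdef]
  have hcoefQ : ∀ j, Q.coeff j = Polynomial.X * Polynomial.C (T.coeff j) + if j = 1 then 1 else 0 := by
    intro j
    rw [hQdef, Polynomial.coeff_add, Polynomial.coeff_C_mul, Polynomial.coeff_map]
    by_cases h : j = 1
    · subst h; simp
    · rw [if_neg h, Polynomial.coeff_X_of_ne_one h]
  have hN : ∀ j, (Q.coeff j).natDegree ≤ 1 := by
    intro j
    rw [hcoefQ]
    refine (Polynomial.natDegree_add_le _ _).trans (max_le ?_ ?_)
    · exact (Polynomial.natDegree_mul_le).trans (by simp)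
    · split_ifs <;> simp
  have hT : ∀ j, T.coeff j = (Q.coeff j).coeff 1 := by
    intro j
    rw [hcoefQ, Polynomial.coeff_add, Polynomial.coeff_X_mul, Polynomial.coeff_C_zero]
    split_ifs <;> simp [Polynomial.coeff_one]
  have hT₁ : ∀ j, (Polynomial.X : Polynomial ℂ).coeff j = (Q.coeff j).coeff (1 - 1) := by
    intro j
    rw [hcoefQ, Nat.sub_self, Polynomial.coeff_add, Polynomial.mul_coeff_zero, Polynomial.coeff_X_zero,
      zero_mul, zero_add]
    by_cases h : j = 1
    · subst h; simp
    · rw [if_neg h, Polynomial.coeff_X_of_ne_one h, Polynomial.coeff_zero]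
  have hT0 : T ≠ 0 := by rw [hTdef]; exact pow_ne_zero _ (Polynomial.X_sub_C_ne_zero 1)
  have hTθ : T.IsRoot 1 := by
    rw [hTdef, Polynomial.IsRoot, Polynomial.eval_pow, Polynomial.eval_sub, Polynomial.eval_X,
      Polynomial.eval_C, sub_self, zero_pow hk0]
  have hT₁θ : ¬ (Polynomial.X : Polynomial ℂ).IsRoot 1 := by simp
  refine ⟨mmCase_fibreCurveSurface p hd hirr ?_, ?_⟩
  · -- infinitely many `t` with a nonzero fibre point: every `t ∉ {0, -1}`
    refine ((Set.finite_singleton (0 : ℂ)).insert (-1)).infinite_compl.mono ?_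
    intro t ht
    simp only [Set.mem_compl_iff, Set.mem_insert_iff, Set.mem_singleton_iff, not_or] at ht
    obtain ⟨ht1, ht0⟩ := ht
    set q : Polynomial ℂ := Polynomial.C t * (Polynomial.X - Polynomial.C 1) ^ k + Polynomial.X with hq
    have hqdeg : q.degree ≠ 0 := by
      intro h
      have hc := Polynomial.eq_C_of_degree_eq_zero h
      have h1 := congrArg (fun f : Polynomial ℂ => f.eval 2 - f.eval 1) hc
      simp only [hq, Polynomial.eval_add, Polynomial.eval_mul, Polynomial.eval_C, Polynomial.eval_pow,
        Polynomial.eval_sub, Polynomial.eval_X, sub_self, zero_pow hk0, mul_zero, zero_add] at h1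
      norm_num at h1
      exact ht1 (by linear_combination h1)
    obtain ⟨y, hy⟩ := IsAlgClosed.exists_root q hqdeg
    have hy' : t * (y - 1) ^ k + y = 0 := by
      have := hy.eq_zero
      simp only [hq, Polynomial.eval_add, Polynomial.eval_mul, Polynomial.eval_C, Polynomial.eval_pow,
        Polynomial.eval_sub, Polynomial.eval_X] at this
      exact this
    refine ⟨y, ?_, ?_⟩
    · rintro rfl
      apply ht0
      have h := hy'
      rw [zero_sub, add_zero, neg_one_pow_eq_pow_mod_two] at h
      rcases Nat.mod_two_eq_zero_or_one k with h2 | h2 <;> rw [h2] at h <;> simpa using h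
    · simp only [hPdef, map_add, map_mul, map_pow, map_sub, map_one, MvPolynomial.eval_X,
        Matrix.cons_val_zero, Matrix.cons_val_one]
      exact hy'
  · refine unprojectedDense_graph_ramifiedTopRow_unramified Q hP hirr 1 le_rfl hN T Polynomial.X hT hT₁ hT0
      one_ne_zero hTθ hT₁θ (Or.inl ⟨0, ?_, ?_⟩) p hd
    · rw [hcoefQ]; simp
    · rw [hcoefQ]; simp

/-- **`{x₁ = x₀³, x₀y₀² + (1 - 2x₀)y₀ + x₀ = 0}` has Zariski-dense exponential points** — top row
`(X - 1)²`, a double root and no simple nonzero root: the first decided member of the class left open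
after gen 25. [cite: MantovaMasser2023, §1 Further remarks, p. 5 (the question, open in general)]
(new) -/
theorem unprojectedDense_cubicGraph_doubleRootFibre :
    UnprojectedDense {w : Fin 2 ⊕ Fin 2 → ℂ | w (Sum.inl 1) = w (Sum.inl 0) ^ 3 ∧
      w (Sum.inl 0) * w (Sum.inr 0) ^ 2 + (1 - 2 * w (Sum.inl 0)) * w (Sum.inr 0) + w (Sum.inl 0) = 0} := by
  have h := (unprojectedDensityQuestion_graph_ramifiedCycleFibre (k := 2) (by norm_num) (Polynomial.X ^ 3)
    (by rw [Polynomial.natDegree_X_pow]; norm_num)).2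
  have hset : {w : Fin 2 ⊕ Fin 2 → ℂ | w (Sum.inl 1) = w (Sum.inl 0) ^ 3 ∧
      w (Sum.inl 0) * w (Sum.inr 0) ^ 2 + (1 - 2 * w (Sum.inl 0)) * w (Sum.inr 0) + w (Sum.inl 0) = 0} =
      {w : Fin 2 ⊕ Fin 2 → ℂ | w (Sum.inl 1) = (Polynomial.X ^ 3 : Polynomial ℂ).eval (w (Sum.inl 0)) ∧
        w (Sum.inl 0) * (w (Sum.inr 0) - 1) ^ 2 + w (Sum.inr 0) = 0} := by
    ext w
    simp only [Set.mem_setOf_eq, Polynomial.eval_pow, Polynomial.eval_X]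
    constructor
    · rintro ⟨h1, h2⟩; exact ⟨h1, by linear_combination h2⟩
    · rintro ⟨h1, h2⟩; exact ⟨h1, by linear_combination h2⟩
  rw [hset]
  exact h

end Summit.Schanuel.Schanuel.Theorems
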